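import Summits.Ventures.PercRepro.S1CoreCapChain
import Summits.Ventures.PercRepro.S1PerFlatCount

/-!
# PercRepro — THE AVERAGING CHAIN FOR `s₅` BY NULLITY, UNCONDITIONAL: `432, 702, 1092, 1638, 2382, 3374, 4671, 6339, …`
at `ν = 7, 8, 9, 10, 11, 12, 13, 14, …` (p2, gen 20; SUBCLAIM-S1 §6.4)

p1's averaging recursion for `s₄` (S1CoreCapAvg) transposed to the five-circuits: over the points the five-circuits
through a point sum to `5·s₅` (`sum_ncard_fiveCircuitsThrough_eq`); coloops lie on no circuit, so some non-coloop `x`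
lies on at most `⌊5·s₅/m⌋` five-circuits, `m` the number of non-coloops (`exists_nonColoop_ncard_fiveCircuitsThrough_le`);
`M ＼ {x}` is a core of nullity one less with `s₅(M) ≤ #5circ(x) + s₅(M ＼ {x})`
(`ncard_fiveCircuits_le_through_add_delete`) — so `s₅(ν) − ⌊5·s₅(ν)/m⌋ ≤ s₅(ν − 1)`, i.e. `s₅(ν) ≤ ⌊m·s₅(ν − 1)/(m − 5)⌋`
(`le_mul_div_of_sub_div_le_five`). With `m ≥ ν + 5` at `ν ≥ 7` (p1's `card_nonColoops_ge`) and the crude count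
`s₅ ≤ C(ν + 4, 5)` (`ncard_circuits_five_le`) as the base at `ν ≤ 6` (`56, 126, 252` at `ν = 4, 5, 6`):

    ν       6    7    8     9    10    11    12    13    14    15
    m       –   12   13    14    15    16    17    18    19    20
    s₅ ≤  252  432  702  1092  1638  2382  3374  4671  6339  8452

against the crude `C(ν + 4, 5) = 462, 792, 1287, 2002, 3003, 4368, 6188, 8568, 11628`. What it buys on the S1 map:
the cell `(9, 14)` (`s₅ ≤ 6339` at nullity `14` against the cell's need `≤ 6407` with the `s₄` chain's `611`).

* `ncard_fiveCircuits_le_through_add_delete`, `sum_ncard_fiveCircuitsThrough_eq`,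
  `exists_nonColoop_ncard_fiveCircuitsThrough_le`, `ncard_fiveCircuits_sub_div_le_of_nonColoops`;
* `avgChain5`, **`ncard_fiveCircuits_le_avgChain5`**, `avgChain5_values`, `ncard_fiveCircuits_le_avgChain5_fourteen`.
Axioms: standard.
-/

open scoped Matroid

namespace PercRepro

namespace S1

open Set

open FourCap

variable {α : Type}

/-- The 5-circuits of `M` are at most those through `e` plus those of `M ＼ {e}` (p1's `S1CoreSplit` for size `5`). -/
theorem ncard_fiveCircuits_le_through_add_delete (M : Matroid α) [M.Finite] (e : α) :
    {C : Set α | M.IsCircuit C ∧ C.ncard = 5}.ncard ≤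
      {C : Set α | M.IsCircuit C ∧ C.ncard = 5 ∧ e ∈ C}.ncard +
        {C : Set α | (M ＼ {e}).IsCircuit C ∧ C.ncard = 5}.ncard := by
  classical
  set S := {C : Set α | M.IsCircuit C ∧ C.ncard = 5} with hS
  set S₁ := {C : Set α | M.IsCircuit C ∧ C.ncard = 5 ∧ e ∈ C} with hS₁
  set S₂ := {C : Set α | (M ＼ {e}).IsCircuit C ∧ C.ncard = 5} with hS₂
  have hS₁fin : S₁.Finite :=
    M.ground_finite.finite_subsets.subset (fun C hC => hC.1.subset_ground)
  have hS₂fin : S₂.Finite :=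
    (M ＼ {e}).ground_finite.finite_subsets.subset (fun C hC => hC.1.subset_ground)
  have hsplit : S ⊆ S₁ ∪ S₂ := by
    intro C hC
    by_cases h : e ∈ C
    · exact Or.inl ⟨hC.1, hC.2, h⟩
    · exact Or.inr ⟨_root_.Matroid.delete_isCircuit_iff.2 ⟨hC.1, disjoint_singleton_right.2 h⟩, hC.2⟩
  calc S.ncard ≤ (S₁ ∪ S₂).ncard := ncard_le_ncard hsplit (hS₁fin.union hS₂fin)
    _ ≤ S₁.ncard + S₂.ncard := ncard_union_le _ _

open Classical in
/-- **Double count**: over the points of the ground set, the 5-circuits through a point sum to `5 · s₅`. -/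
theorem sum_ncard_fiveCircuitsThrough_eq (M : Matroid α) [M.Finite] :
    ∑ x ∈ M.ground_finite.toFinset, {C : Set α | M.IsCircuit C ∧ C.ncard = 5 ∧ x ∈ C}.ncard =
      5 * {C : Set α | M.IsCircuit C ∧ C.ncard = 5}.ncard := by
  have hS : {C : Set α | M.IsCircuit C ∧ C.ncard = 5}.Finite :=
    M.ground_finite.finite_subsets.subset (fun C hC => hC.1.subset_ground)
  set Sf := hS.toFinset with hSf
  have h1 : ∀ x, {C : Set α | M.IsCircuit C ∧ C.ncard = 5 ∧ x ∈ C}.ncard = (Sf.filter (fun C => x ∈ C)).card := by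
    intro x
    rw [← ncard_coe_finset]
    congr 1
    ext C
    simp only [Finset.coe_filter, hSf, Set.Finite.mem_toFinset, mem_setOf_eq]
    tauto
  have h2 : ∀ C ∈ Sf, (M.ground_finite.toFinset.filter (fun x => x ∈ C)).card = 5 := by
    intro C hC
    rw [hSf, Set.Finite.mem_toFinset] at hC
    have : (M.ground_finite.toFinset.filter (fun x => x ∈ C) : Set α) = C := by
      ext x
      simp only [Finset.coe_filter, Set.Finite.mem_toFinset, mem_setOf_eq]
      exact ⟨fun h => h.2, fun h => ⟨hC.1.subset_ground h, h⟩⟩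
    rw [← ncard_coe_finset, this, hC.2]
  calc ∑ x ∈ M.ground_finite.toFinset, {C : Set α | M.IsCircuit C ∧ C.ncard = 5 ∧ x ∈ C}.ncard
      = ∑ x ∈ M.ground_finite.toFinset, ∑ C ∈ Sf, (if x ∈ C then 1 else 0) := by
        refine Finset.sum_congr rfl (fun x _ => ?_); rw [h1 x, Finset.card_filter]
    _ = ∑ C ∈ Sf, ∑ x ∈ M.ground_finite.toFinset, (if x ∈ C then 1 else 0) := Finset.sum_comm
    _ = ∑ C ∈ Sf, 5 := by
        refine Finset.sum_congr rfl (fun C hC => ?_); rw [← Finset.card_filter, h2 C hC]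
    _ = 5 * {C : Set α | M.IsCircuit C ∧ C.ncard = 5}.ncard := by
        rw [Finset.sum_const, smul_eq_mul, mul_comm, hSf, ← ncard_eq_toFinset_card _ hS]

/-- A coloop lies on no 5-circuit. -/
theorem ncard_fiveCircuitsThrough_eq_zero_of_isColoop (M : Matroid α) {x : α} (hx : M.IsColoop x) :
    {C : Set α | M.IsCircuit C ∧ C.ncard = 5 ∧ x ∈ C}.ncard = 0 := by
  have : {C : Set α | M.IsCircuit C ∧ C.ncard = 5 ∧ x ∈ C} = ∅ := by
    ext C; simp only [mem_setOf_eq, mem_empty_iff_false, iff_false]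
    rintro ⟨hC, _, hxC⟩
    exact hC.not_isColoop_of_mem hxC hx
  rw [this, ncard_empty]

open Classical in
/-- **Averaging**: if `s₅ > 0`, some non-coloop `x` lies on at most `⌊5·s₅ / m⌋` five-circuits, where `m` is the
number of non-coloops. -/
theorem exists_nonColoop_ncard_fiveCircuitsThrough_le (M : Matroid α) [M.Finite]
    (hpos : 0 < {C : Set α | M.IsCircuit C ∧ C.ncard = 5}.ncard) :
    ∃ x ∈ M.E, ¬ M.IsColoop x ∧ {C : Set α | M.IsCircuit C ∧ C.ncard = 5 ∧ x ∈ C}.ncard ≤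
      5 * {C : Set α | M.IsCircuit C ∧ C.ncard = 5}.ncard /
        (M.ground_finite.toFinset.filter (fun x => ¬ M.IsColoop x)).card := by
  have hS : {C : Set α | M.IsCircuit C ∧ C.ncard = 5}.Finite :=
    M.ground_finite.finite_subsets.subset (fun C hC => hC.1.subset_ground)
  have hsum : ∑ x ∈ M.ground_finite.toFinset.filter (fun x => ¬ M.IsColoop x),
      {C : Set α | M.IsCircuit C ∧ C.ncard = 5 ∧ x ∈ C}.ncard = 5 * {C : Set α | M.IsCircuit C ∧ C.ncard = 5}.ncard := by
    rw [Finset.sum_filter_of_ne]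
    · exact sum_ncard_fiveCircuitsThrough_eq M
    · intro x _ hfx hcol
      exact hfx (ncard_fiveCircuitsThrough_eq_zero_of_isColoop M hcol)
  -- the non-coloops are nonempty: a point of a 5-circuit
  have hm : 0 < (M.ground_finite.toFinset.filter (fun x => ¬ M.IsColoop x)).card := by
    obtain ⟨C₀, hC₀⟩ := (ncard_pos hS).1 hpos
    obtain ⟨x₀, hx₀⟩ := hC₀.1.nonempty
    refine Finset.card_pos.2 ⟨x₀, ?_⟩
    rw [Finset.mem_filter, Set.Finite.mem_toFinset]
    exact ⟨hC₀.1.subset_ground hx₀, hC₀.1.not_isColoop_of_mem hx₀⟩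
  by_contra hno
  push Not at hno
  have hall : ∀ x ∈ M.ground_finite.toFinset.filter (fun x => ¬ M.IsColoop x),
      5 * {C : Set α | M.IsCircuit C ∧ C.ncard = 5}.ncard /
        (M.ground_finite.toFinset.filter (fun x => ¬ M.IsColoop x)).card + 1 ≤
        {C : Set α | M.IsCircuit C ∧ C.ncard = 5 ∧ x ∈ C}.ncard := by
    intro x hx
    have hx' := hx
    rw [Finset.mem_filter, Set.Finite.mem_toFinset] at hx'
    have := hno x hx'.1 hx'.2
    omega
  have hge := Finset.card_nsmul_le_sum _ _ _ hall
  rw [smul_eq_mul, hsum] at hge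
  have hdm := Nat.div_add_mod (5 * {C : Set α | M.IsCircuit C ∧ C.ncard = 5}.ncard)
    (M.ground_finite.toFinset.filter (fun x => ¬ M.IsColoop x)).card
  have hmod := Nat.mod_lt (5 * {C : Set α | M.IsCircuit C ∧ C.ncard = 5}.ncard) hm
  have hmul : (M.ground_finite.toFinset.filter (fun x => ¬ M.IsColoop x)).card *
      (5 * {C : Set α | M.IsCircuit C ∧ C.ncard = 5}.ncard /
        (M.ground_finite.toFinset.filter (fun x => ¬ M.IsColoop x)).card + 1) =
      (M.ground_finite.toFinset.filter (fun x => ¬ M.IsColoop x)).card *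
      (5 * {C : Set α | M.IsCircuit C ∧ C.ncard = 5}.ncard /
        (M.ground_finite.toFinset.filter (fun x => ¬ M.IsColoop x)).card) +
      (M.ground_finite.toFinset.filter (fun x => ¬ M.IsColoop x)).card := by ring
  omega

open Classical in
/-- **The averaging recursion for `s₅` with an explicit count of non-coloops**: on a core of nullity `d + 1` with at
least `m ≥ 1` non-coloops, if every core of nullity `d` has `s₅ ≤ B`, then `s₅ − ⌊5·s₅/m⌋ ≤ B`. -/
theorem ncard_fiveCircuits_sub_div_le_of_nonColoops (M : Matroid α) [M.Finite]
    (hfree : ∀ e ∈ M.E, ∃ A ⊆ M.E \ {e}, e ∉ M.closure A ∧ e ∉ M.closure ((M.E \ {e}) \ A))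
    {d : ℕ} (hd : M.E.encard = M.eRank + (d + 1)) {m : ℕ} (hm0 : 0 < m)
    (hm : m ≤ (M.E \ M.coloops).ncard) {B : ℕ}
    (hB : ∀ (M' : Matroid α) [M'.Finite],
      (∀ e ∈ M'.E, ∃ A ⊆ M'.E \ {e}, e ∉ M'.closure A ∧ e ∉ M'.closure ((M'.E \ {e}) \ A)) →
      M'.E.encard = M'.eRank + d → {C : Set α | M'.IsCircuit C ∧ C.ncard = 5}.ncard ≤ B) :
    {C : Set α | M.IsCircuit C ∧ C.ncard = 5}.ncard -
      5 * {C : Set α | M.IsCircuit C ∧ C.ncard = 5}.ncard / m ≤ B := by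
  rcases Nat.eq_zero_or_pos {C : Set α | M.IsCircuit C ∧ C.ncard = 5}.ncard with h0 | hpos
  · rw [h0]; simp
  obtain ⟨x, hxE, hxc, hx⟩ := exists_nonColoop_ncard_fiveCircuitsThrough_le M hpos
  have hm' : m ≤ (M.ground_finite.toFinset.filter (fun x => ¬ M.IsColoop x)).card := by
    have : (M.ground_finite.toFinset.filter (fun x => ¬ M.IsColoop x) : Set α) = M.E \ M.coloops := by
      ext y; simp only [Finset.coe_filter, Set.Finite.mem_toFinset, mem_setOf_eq, mem_sdiff,
        Matroid.isColoop_iff_mem_coloops]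
    rw [← ncard_coe_finset, this]
    exact hm
  have hx' : {C : Set α | M.IsCircuit C ∧ C.ncard = 5 ∧ x ∈ C}.ncard ≤
      5 * {C : Set α | M.IsCircuit C ∧ C.ncard = 5}.ncard / m :=
    hx.trans (Nat.div_le_div_left hm' hm0)
  have hν : M✶.eRank = ((d + 1 : ℕ) : ℕ∞) := by
    have h := _root_.Matroid.eRank_add_eRank_dual M
    rw [hd] at h
    exact WithTop.add_left_cancel (PercRepro.Matroid.eRank_ne_top_of_finite M) h
  have hdel := PercRepro.Matroid.dual_eRank_delete_singleton_add_one hxE hxc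
  rw [hν] at hdel
  have hfin' : (M ＼ {x})✶.eRank ≠ ⊤ := by
    intro h
    rw [h] at hdel
    have h2 : ((d + 1 : ℕ) : ℕ∞) = ⊤ := by rw [← hdel]; simp
    exact ENat.coe_ne_top _ h2
  obtain ⟨d', hd'⟩ := ENat.ne_top_iff_exists.1 hfin'
  have hdd' : d = d' := by
    rw [← hd'] at hdel
    have : d' + 1 = d + 1 := by exact_mod_cast hdel
    omega
  subst hdd'
  have hd'enc : (M ＼ {x}).E.encard = (M ＼ {x}).eRank + d := by
    have h := _root_.Matroid.eRank_add_eRank_dual (M ＼ {x})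
    rw [← hd'] at h
    exact h.symm
  have hB' := hB (M ＼ {x}) (hfree_delete M hfree x) hd'enc
  have hsplit := ncard_fiveCircuits_le_through_add_delete M x
  omega

/-- `s − ⌊5s/m⌋ ≤ B` with `m > 5` gives `s ≤ ⌊m·B/(m − 5)⌋` (p1's `le_mul_div_of_sub_div_le` for `5`). -/
theorem le_mul_div_of_sub_div_le_five {s B m : ℕ} (hm : 5 < m) (h : s - 5 * s / m ≤ B) :
    s ≤ m * B / (m - 5) := by
  have h1 : s ≤ B + 5 * s / m := by omega
  have h2 : m * (5 * s / m) ≤ 5 * s := Nat.mul_div_le (5 * s) m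
  have h3 : m * s ≤ m * B + 5 * s := by nlinarith [Nat.mul_le_mul_left m h1]
  have h4 : (m - 5) * s ≤ m * B := by
    have : (m - 5) * s = m * s - 5 * s := by rw [Nat.sub_mul]
    omega
  exact (Nat.le_div_iff_mul_le (by omega)).2 (by rw [mul_comm]; exact h4)

/-- The unconditional averaging chain for `s₅`: the crude count `C(ν + 4, 5) = 0, 1, 6, 21, 56, 126, 252` at
`ν ≤ 6`, then `avgChain5 (n + 7) = ⌊(n + 12)·avgChain5 (n + 6)/(n + 7)⌋` (`m = n + 12` non-coloops at nullity
`n + 7`): `432, 702, 1092, 1638, 2382, 3374, 4671, 6339, 8452, …`. -/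
def avgChain5 : ℕ → ℕ
  | 0 => 0
  | 1 => 1
  | 2 => 6
  | 3 => 21
  | 4 => 56
  | 5 => 126
  | 6 => 252
  | n + 7 => (n + 12) * avgChain5 (n + 6) / (n + 12 - 5)

/-- The values `avgChain5 7 = 432`, `8 ↦ 702`, `9 ↦ 1092`, `10 ↦ 1638`, `11 ↦ 2382`, `12 ↦ 3374`, `13 ↦ 4671`,
`14 ↦ 6339`. -/
theorem avgChain5_values : avgChain5 7 = 432 ∧ avgChain5 8 = 702 ∧ avgChain5 9 = 1092 ∧ avgChain5 10 = 1638 ∧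
    avgChain5 11 = 2382 ∧ avgChain5 12 = 3374 ∧ avgChain5 13 = 4671 ∧ avgChain5 14 = 6339 := by decide

/-- The chain starts at the crude count: `C(j + 4, 5) ≤ avgChain5 j` for `j ≤ 6` (equality). -/
theorem choose_le_avgChain5 : (0 + 4).choose 5 ≤ avgChain5 0 ∧ (1 + 4).choose 5 ≤ avgChain5 1 ∧
    (2 + 4).choose 5 ≤ avgChain5 2 ∧ (3 + 4).choose 5 ≤ avgChain5 3 ∧ (4 + 4).choose 5 ≤ avgChain5 4 ∧
    (5 + 4).choose 5 ≤ avgChain5 5 ∧ (6 + 4).choose 5 ≤ avgChain5 6 := by decide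

/-- **`s₅ ≤ avgChain5 ν` on every core of nullity `ν`, unconditionally.** -/
theorem ncard_fiveCircuits_le_avgChain5 : ∀ (j : ℕ) (M : Matroid α) [M.Finite],
    (∀ e ∈ M.E, ∃ A ⊆ M.E \ {e}, e ∉ M.closure A ∧ e ∉ M.closure ((M.E \ {e}) \ A)) →
    M.E.encard = M.eRank + j → {C : Set α | M.IsCircuit C ∧ C.ncard = 5}.ncard ≤ avgChain5 j
  | 0, M, _, _, hd => (ncard_circuits_five_le M hd).trans choose_le_avgChain5.1
  | 1, M, _, _, hd => (ncard_circuits_five_le M hd).trans choose_le_avgChain5.2.1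
  | 2, M, _, _, hd => (ncard_circuits_five_le M hd).trans choose_le_avgChain5.2.2.1
  | 3, M, _, _, hd => (ncard_circuits_five_le M hd).trans choose_le_avgChain5.2.2.2.1
  | 4, M, _, _, hd => (ncard_circuits_five_le M hd).trans choose_le_avgChain5.2.2.2.2.1
  | 5, M, _, _, hd => (ncard_circuits_five_le M hd).trans choose_le_avgChain5.2.2.2.2.2.1
  | 6, M, _, _, hd => (ncard_circuits_five_le M hd).trans choose_le_avgChain5.2.2.2.2.2.2
  | n + 7, M, _, hfree, hd => by
    have hd' : M.E.encard = M.eRank + ((n + 6 : ℕ) + 1) := by rw [hd]; push_cast; ring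
    have hm : n + 12 ≤ (M.E \ M.coloops).ncard := card_nonColoops_ge M hfree hd' (by omega)
    have h := ncard_fiveCircuits_sub_div_le_of_nonColoops M hfree hd' (by omega) hm
      (fun M' _ hfree' hd6 => ncard_fiveCircuits_le_avgChain5 (n + 6) M' hfree' hd6)
    have h2 := le_mul_div_of_sub_div_le_five (m := n + 12) (by omega) h
    show _ ≤ (n + 12) * avgChain5 (n + 6) / (n + 12 - 5)
    exact h2

/-- **`s₅ ≤ 6339` on every core of nullity `14`**, unconditionally (the crude count is `8568`; the cell `(9, 14)`
needs `≤ 6407`). -/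
theorem ncard_fiveCircuits_le_avgChain5_fourteen (M : Matroid α) [M.Finite]
    (hfree : ∀ e ∈ M.E, ∃ A ⊆ M.E \ {e}, e ∉ M.closure A ∧ e ∉ M.closure ((M.E \ {e}) \ A))
    (hd : M.E.encard = M.eRank + 14) : {C : Set α | M.IsCircuit C ∧ C.ncard = 5}.ncard ≤ 6339 := by
  have h := ncard_fiveCircuits_le_avgChain5 14 M hfree (by exact_mod_cast hd)
  rwa [avgChain5_values.2.2.2.2.2.2.2] at h

end S1

end PercRepro
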